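import Summits.QuantumAdvantage.AdviceFreeQNC0.DiversityRungs
import HarnessLib

/-!
# Cell qa-qnc0 (rung F-Q1, crux of record `TensorMultOneAt`): norm-agnostic rungs for ANY block
# structure — the pattern-triple certificate, and `Div2222PaysEight` (Sketch13 v4 §DiversityRungs)

Sequel of `DiversityRungs.lean` (planner qa-qnc0-p1 Sketch13 v4, ROUND-12 §2.10(vi)).  A last player
measurable w.r.t. `blocks : Fin s → Finset (Fin m)` shows, at own-block content `u`, a value that depends
only on the residue `|u| mod 3` and the PARITY PATTERN `π(u) ∈ {0,1}^s` of `u` on the blocks; for every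
pattern `π` the three values `c₀ + L₀(π)`, `c₁ + L₁(π)`, `c₀ + c₁ + e + L₀(π) + L₁(π)` sum to `e` in a
group of exponent `2`.  Hence (subadditivity, nonnegativity):

* `diversityPays_patterns`: `DiversityPays m s blocks (Σ_π min_ρ N(ρ, π))`,
  `N(ρ, π) = #{u : |u| ≡ ρ (3), π(u) = π}` — the PATTERN-TRIPLE certificate (for `s = 1` and the block
  `univ` this is `diversityPays_sym`);
* `div2222PaysEight : Div2222PaysEight` — `m = 8`, blocks `(2,2,2,2)`: the certificate is worth
  `5 + 16 + 24 = 45 = w(8,1)` (patterns with `0, 1, 2` odd blocks; evaluated by `decide`).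

WHAT THIS IS NOT: the pattern-triple certificate is in general BELOW the planner's LP value `V_s`
(it happens to reach `w(8,1)` for `(2,2,2,2)` and `w(m,1)` for `s = 1`); unrestricted last players =
MULT₁ itself, OPEN; nothing on α; separation NOT moved.
-/

noncomputable section

namespace Summit.QuantumAdvantage.AdviceFreeQNC0

open Finset
open Literature.Computability.MetaComplexity

namespace DiversityRungs

variable {m s : ℕ}

/-- The parity pattern of `u` on the blocks. -/
def pat (blocks : Fin s → Finset (Fin m)) (u : Fin m → Bool) : Fin s → Bool :=
  fun j => blockPar (blocks j) u

/-- `N(ρ, π) = #{u : |u| ≡ ρ (mod 3), π(u) = π}`. -/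
def Npat (blocks : Fin s → Finset (Fin m)) (ρ : ℕ) (π : Fin s → Bool) : ℕ :=
  (univ.filter fun u : Fin m → Bool => wt u % 3 = ρ ∧ pat blocks u = π).card

/-- The value of a block-measurable last player as a function of (residue, pattern). -/
def pval {Q : Type} [AddCommGroup Q] (c₀ c₁ e : Q) (g₀ g₁ : Fin s → Q) (ρ : ℕ) (π : Fin s → Bool) : Q :=
  if ρ = 0 then c₀ + ∑ j : Fin s, (if π j then g₀ j else 0)
  else if ρ = 1 then c₁ + ∑ j : Fin s, (if π j then g₁ j else 0)
  else c₀ + c₁ + e + ∑ j : Fin s, (if π j then g₀ j else 0) + ∑ j : Fin s, (if π j then g₁ j else 0)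

/-- The last player's value is `pval` of `(|u| mod 3, π(u))`. -/
theorem lastPlayerVal_eq_pval {Q : Type} [AddCommGroup Q] (blocks : Fin s → Finset (Fin m))
    (c₀ c₁ e : Q) (g₀ g₁ : Fin s → Q) (u : Fin m → Bool) :
    lastPlayerVal blocks c₀ c₁ e g₀ g₁ u = pval c₀ c₁ e g₀ g₁ (wt u % 3) (pat blocks u) := by
  unfold lastPlayerVal pval pat
  rfl

/-- For every pattern the three values of the triple sum to `e` (exponent `2`). -/
theorem pval_triple {Q : Type} [AddCommGroup Q] (h2 : ∀ x : Q, x + x = 0) (c₀ c₁ e : Q)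
    (g₀ g₁ : Fin s → Q) (π : Fin s → Bool) :
    pval c₀ c₁ e g₀ g₁ 0 π + pval c₀ c₁ e g₀ g₁ 1 π + pval c₀ c₁ e g₀ g₁ 2 π = e := by
  unfold pval
  simp only [if_true, show (1 : ℕ) ≠ 0 from one_ne_zero, show (2 : ℕ) ≠ 0 from two_ne_zero,
    show (2 : ℕ) ≠ 1 from by norm_num, if_false]
  set L₀ := ∑ j : Fin s, (if π j then g₀ j else 0)
  set L₁ := ∑ j : Fin s, (if π j then g₁ j else 0)
  calc c₀ + L₀ + (c₁ + L₁) + (c₀ + c₁ + e + L₀ + L₁)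
      = (c₀ + c₀) + (c₁ + c₁) + (L₀ + L₀) + (L₁ + L₁) + e := by abel
    _ = e := by rw [h2 c₀, h2 c₁, h2 L₀, h2 L₁]; abel

/-- The cost summed by (residue, pattern) classes. -/
theorem sum_nrm_eq_patterns {Q : Type} [AddCommGroup Q] (nrm : Q → ℝ)
    (blocks : Fin s → Finset (Fin m)) (c₀ c₁ e : Q) (g₀ g₁ : Fin s → Q) :
    ∑ u : Fin m → Bool, nrm (lastPlayerVal blocks c₀ c₁ e g₀ g₁ u) =
      ∑ π : Fin s → Bool, ∑ ρ ∈ range 3, (Npat blocks ρ π : ℝ) * nrm (pval c₀ c₁ e g₀ g₁ ρ π) := by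
  classical
  simp_rw [lastPlayerVal_eq_pval]
  rw [← sum_fiberwise_of_maps_to (s := (univ : Finset (Fin m → Bool)))
    (t := (range 3) ×ˢ (univ : Finset (Fin s → Bool)))
    (g := fun u => (wt u % 3, pat blocks u))
    (fun u _ => mem_product.2 ⟨mem_range.2 (Nat.mod_lt _ (by norm_num)), mem_univ _⟩)]
  rw [Finset.sum_product, Finset.sum_comm]
  refine Finset.sum_congr rfl fun π _ => Finset.sum_congr rfl fun ρ _ => ?_
  have hfib : ∀ u ∈ univ.filter (fun u : Fin m → Bool => (wt u % 3, pat blocks u) = (ρ, π)),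
      nrm (pval c₀ c₁ e g₀ g₁ (wt u % 3) (pat blocks u)) = nrm (pval c₀ c₁ e g₀ g₁ ρ π) := by
    intro u hu
    have h := (mem_filter.1 hu).2
    rw [Prod.mk.injEq] at h
    rw [h.1, h.2]
  rw [Finset.sum_congr rfl hfib, Finset.sum_const, nsmul_eq_mul]
  have hset : (univ.filter fun u : Fin m → Bool => (wt u % 3, pat blocks u) = (ρ, π)) =
      univ.filter fun u : Fin m → Bool => wt u % 3 = ρ ∧ pat blocks u = π := by
    ext u; simp only [mem_filter, mem_univ, true_and, Prod.mk.injEq]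
  rw [hset]
  rfl

/-- **The pattern-triple certificate**: `DiversityPays m s blocks (Σ_π min_ρ N(ρ, π))` for EVERY block
structure. -/
theorem diversityPays_patterns (m s : ℕ) (blocks : Fin s → Finset (Fin m)) :
    DiversityPays m s blocks
      ((∑ π : Fin s → Bool, min (min (Npat blocks 0 π) (Npat blocks 1 π)) (Npat blocks 2 π) : ℕ) : ℝ) := by
  classical
  intro Q _ nrm hsub hnn h2 c₀ c₁ e g₀ g₁
  rw [sum_nrm_eq_patterns, Nat.cast_sum, Finset.sum_mul]
  refine Finset.sum_le_sum fun π _ => ?_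
  set M := min (min (Npat blocks 0 π) (Npat blocks 1 π)) (Npat blocks 2 π) with hM
  have e0 : (M : ℝ) ≤ Npat blocks 0 π := by exact_mod_cast (min_le_left _ _).trans (min_le_left _ _)
  have e1 : (M : ℝ) ≤ Npat blocks 1 π := by exact_mod_cast (min_le_left _ _).trans (min_le_right _ _)
  have e2 : (M : ℝ) ≤ Npat blocks 2 π := by exact_mod_cast min_le_right _ _
  have hM0 : (0 : ℝ) ≤ M := Nat.cast_nonneg _
  have htri : nrm e ≤ nrm (pval c₀ c₁ e g₀ g₁ 0 π) + nrm (pval c₀ c₁ e g₀ g₁ 1 π) +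
      nrm (pval c₀ c₁ e g₀ g₁ 2 π) := by
    have hs : nrm (pval c₀ c₁ e g₀ g₁ 0 π + pval c₀ c₁ e g₀ g₁ 1 π + pval c₀ c₁ e g₀ g₁ 2 π) ≤
        nrm (pval c₀ c₁ e g₀ g₁ 0 π) + nrm (pval c₀ c₁ e g₀ g₁ 1 π) + nrm (pval c₀ c₁ e g₀ g₁ 2 π) :=
      (hsub _ _).trans (by linarith [hsub (pval c₀ c₁ e g₀ g₁ 0 π) (pval c₀ c₁ e g₀ g₁ 1 π)])
    rwa [pval_triple h2 c₀ c₁ e g₀ g₁ π] at hs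
  have n0 := hnn (pval c₀ c₁ e g₀ g₁ 0 π)
  have n1 := hnn (pval c₀ c₁ e g₀ g₁ 1 π)
  have n2 := hnn (pval c₀ c₁ e g₀ g₁ 2 π)
  simp only [Finset.sum_range_succ, Finset.sum_range_zero, zero_add]
  nlinarith [mul_le_mul_of_nonneg_right e0 n0, mul_le_mul_of_nonneg_right e1 n1,
    mul_le_mul_of_nonneg_right e2 n2, mul_le_mul_of_nonneg_left htri hM0]

/-- The pattern-triple certificate of the block structure `(2,2,2,2)` on `m = 8` is worth `45`. -/
theorem patternCert_2222 :
    (∑ π : Fin 4 → Bool, min (min (Npat (fun j : Fin 4 => univ.filter fun i : Fin 8 => i.val / 2 = j.val) 0 π)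
      (Npat (fun j : Fin 4 => univ.filter fun i : Fin 8 => i.val / 2 = j.val) 1 π))
      (Npat (fun j : Fin 4 => univ.filter fun i : Fin 8 => i.val / 2 = j.val) 2 π)) = 45 := by
  unfold Npat pat blockPar wt
  decide

end DiversityRungs

open DiversityRungs

/-- **`Div2222PaysEight` — PROVED**: `V = 45` for the blocks `(2,2,2,2)` on `m = 8`, by the pattern-triple
certificate (`5 + 16 + 24`: patterns with `0, 1, 2` odd blocks). -/
theorem div2222PaysEight : Div2222PaysEight := by
  have h := diversityPays_patterns 8 4 (fun j : Fin 4 => univ.filter fun i : Fin 8 => i.val / 2 = j.val)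
  rw [patternCert_2222] at h
  norm_num at h
  exact h

end Summit.QuantumAdvantage.AdviceFreeQNC0
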